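/-
Copyright: H21 programme, solo seat `solo-RiemannHypothesis-informed` (session 5).
-/
import Summits.RiemannHypothesis.RiemannHypothesis.Theorems.SoloInformedUndodgedCluster

/-!
# The δ-free wall: near hypothesis = a COUNT (solo-informed, T38)

The separation parameter `δ` of the near-count wall T36 (`SoloInformedNearCount`) is
eliminated.  Given only a bound `N` on the number of other off-line zeros in the zone
`|Im ρ − γ₀| < e^{a/(2p+2)}`, pigeonhole over the `N + 1` shells
`[δ₀θ^{j+1}, δ₀θ^j)` (`δ₀ = η/(256 a)`, `θ = 1/(64(N+1))`) of the distance to the pair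
`½ ± η + iγ₀` yields an empty shell `j ≤ N`; the zeros outside it (`≥ δ := δ₀θ^j`) are dodged
(T25/T33), the zeros inside it (`< δ₁ := θδ`) are left un-dodged and are gain-signed by the
phase lemma (T37b), hence harmless (T37a).  The window constant is evaluated at the worst shell
`δ_N(η, a) = δ₀θ^N` (`deltaFree`), using that it is antitone in `δ`.

* `weilGroundEnergy_neg_of_nearCount_undodged_eff` — T36 with un-dodged members (T36‴).
* `weilGroundEnergy_neg_of_nearCount_eff` — **T38**: hypotheses `ζ(½+η+iγ₀) = 0`,
  `|γ₀| ≥ 1`, at most `N` other off-line zeros in the zone (a plain count: no separation, no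
  radius, nothing outside the zone), and the explicit window inequality
  `nearCountWindow ψ N p (deltaFree η a N) η γ₀ ≤ a`; conclusion `weilGroundEnergy a < 0`.
* `riemannZeta_ne_zero_of_nearCount_eff` — the exclusion form.
-/

open MeasureTheory Complex Set Filter Topology Literature.NumberTheory.LFunctions
open scoped ContDiff ComplexConjugate

namespace Summit.RiemannHypothesis.RiemannHypothesis.Theorems

variable {ψ : ℝ → ℝ}

/-! ## Monotonicity of the window constants in `δ` -/

/-- The window constant `c₀,p` is antitone in the separation `δ`. -/
theorem clusterFarC0p_anti (ψ : ℝ → ℝ) (N : ℕ) (R₀ : ℝ) (p : ℕ) {δ δ' η : ℝ} (hδ : 0 < δ)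
    (hδδ' : δ ≤ δ') (hη : 0 < η) :
    clusterFarC0p ψ N R₀ p δ' η ≤ clusterFarC0p ψ N R₀ p δ η := by
  unfold clusterFarC0p
  have hK := clusterKp_pos ψ N R₀ p
  have hδ' : 0 < δ' := lt_of_lt_of_le hδ hδδ'
  refine max_le_max le_rfl (div_le_div_of_nonneg_right (Real.log_le_log (by positivity) ?_)
    (by positivity))
  have h1 : 2 * clusterKp ψ N R₀ p / δ' ^ (4 * N) ≤ 2 * clusterKp ψ N R₀ p / δ ^ (4 * N) :=
    div_le_div_of_nonneg_left (by positivity) (by positivity) (pow_le_pow_left₀ hδ.le hδδ' _)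
  have h2 : 4 * (2 * clusterKp ψ N R₀ p / δ' ^ (4 * N)) / (η ^ 4 * bumpLaplace ψ η ^ 2) ≤
      4 * (2 * clusterKp ψ N R₀ p / δ ^ (4 * N)) / (η ^ 4 * bumpLaplace ψ η ^ 2) :=
    div_le_div_of_nonneg_right (by linarith) (by positivity)
  linarith

/-- The near-count window is antitone in the separation `δ`. -/
theorem nearCountWindow_anti (ψ : ℝ → ℝ) (N p : ℕ) {δ δ' η : ℝ} (γ₀ : ℝ) (hδ : 0 < δ)
    (hδδ' : δ ≤ δ') (hη : 0 < η) (hκ : (N : ℝ) < η * (p + 1)) :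
    nearCountWindow ψ N p δ' η γ₀ ≤ nearCountWindow ψ N p δ η γ₀ := by
  unfold nearCountWindow
  have hκ1 : (N : ℝ) / (η * (p + 1)) < 1 := by rw [div_lt_one (by positivity)]; exact hκ
  have h1κ : 0 ≤ 1 - (N : ℝ) / (η * (p + 1)) := by linarith
  have h := clusterFarC0p_anti ψ N 2 p hδ hδδ' hη
  have key : (clusterFarC0p ψ N 2 p δ' η + N / (η * (p + 1)) +
      Real.log (Real.log (|γ₀| + 2)) / (2 * η)) / (1 - N / (η * (p + 1))) ≤
      (clusterFarC0p ψ N 2 p δ η + N / (η * (p + 1)) +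
      Real.log (Real.log (|γ₀| + 2)) / (2 * η)) / (1 - N / (η * (p + 1))) :=
    div_le_div_of_nonneg_right (by linarith) h1κ
  linarith

/-- The near-count window is at least `1`. -/
theorem one_le_nearCountWindow (hψ0 : ∀ s, 0 ≤ ψ s) {η : ℝ} (hη : 0 < η)
    (hΦ : 0 < bumpLaplace ψ η) (N p : ℕ) (hκ : (N : ℝ) < η * (p + 1)) (δ : ℝ) {γ₀ : ℝ}
    (hγ : 1 ≤ |γ₀|) : 1 ≤ nearCountWindow ψ N p δ η γ₀ := by
  unfold nearCountWindow
  have hκ0 : 0 ≤ (N : ℝ) / (η * (p + 1)) := by positivity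
  have hκ1 : (N : ℝ) / (η * (p + 1)) < 1 := by rw [div_lt_one (by positivity)]; exact hκ
  have hL : 1 < Real.log (|γ₀| + 2) := by
    rw [Real.lt_log_iff_exp_lt (by positivity)]
    linarith [Real.exp_one_lt_d9, abs_nonneg γ₀]
  have hLL : 0 ≤ Real.log (Real.log (|γ₀| + 2)) / (2 * η) := by
    have := (Real.log_pos hL).le; positivity
  have hc₂ := clusterFarC0p_nonneg hψ0 hη hΦ N 2 p δ
  have : 0 ≤ (clusterFarC0p ψ N 2 p δ η + N / (η * (p + 1)) +
      Real.log (Real.log (|γ₀| + 2)) / (2 * η)) / (1 - N / (η * (p + 1))) :=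
    div_nonneg (by linarith) (by linarith)
  linarith

/-! ## T36‴: the near-count wall with un-dodged members -/

/-- **T36‴.**  T36 with window `c + 1 ≥ nearCountWindow`, a set `P` of un-dodged zeros
within `δ₁` of the pair (`256(c+1)δ₁ ≤ η`, `64(N+1)δ₁ ≤ δ`) exempted from the near
hypothesis. -/
theorem weilGroundEnergy_neg_of_nearCount_undodged_eff (hψ : ContDiff ℝ ∞ ψ)
    (hsupp : tsupport ψ ⊆ Icc (-1) 1) (hψ0 : ∀ s, 0 ≤ ψ s) {η : ℝ} (hη : 0 < η)
    (hη2 : η < 1 / 2) (hΦ : 0 < bumpLaplace ψ η) (N p : ℕ) (hκ : (N : ℝ) < η * (p + 1))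
    {δ : ℝ} (hδ : 0 < δ) (hδ1 : δ ≤ 1) :
    ∀ (γ₀ c δ₁ : ℝ) (S' P : Finset ℂ), 1 ≤ |γ₀| → nearCountWindow ψ N p δ η γ₀ ≤ c + 1 →
      riemannZeta (1 / 2 + η + γ₀ * I) = 0 → S'.card ≤ N →
      (∀ ρ ∈ S', δ ≤ ‖ρ - (1 / 2 + η + γ₀ * I)‖ ∧ δ ≤ ‖ρ - (1 / 2 - η + γ₀ * I)‖) →
      0 ≤ δ₁ → 256 * (c + 1) * δ₁ ≤ η → 64 * (N + 1) * δ₁ ≤ δ →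
      (∀ ρ ∈ P, riemannZeta ρ = 0 ∧ 0 ≤ ρ.re ∧ ρ.re ≤ 1 ∧ ρ.im ≠ 0 ∧
          (‖ρ - (1 / 2 + η + γ₀ * I)‖ ≤ δ₁ ∨ ‖ρ - (1 / 2 - η + γ₀ * I)‖ ≤ δ₁)) →
      (∀ ρ : ℂ, riemannZeta ρ = 0 → 0 ≤ ρ.re → ρ.re ≤ 1 →
          |ρ.im - γ₀| < Real.exp ((c + 1) / (2 * p + 2)) → ρ.re ≠ 1 / 2 →
          ρ = 1 / 2 + η + γ₀ * I ∨ ρ = 1 / 2 - η + γ₀ * I ∨ ρ ∈ S' ∨ ρ ∈ P) →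
      weilGroundEnergy (c + 1) < 0 := by
  intro γ₀ c δ₁ S' P hγ ha hζ hcard hsep hδ₁ hδ₁η hδ₁δ hP hnear
  set κ : ℝ := N / (η * (p + 1)) with hκ_def
  have hκ0 : 0 ≤ κ := by positivity
  have hκ1 : κ < 1 := by rw [hκ_def, div_lt_one (by positivity)]; exact hκ
  have h1κ : 0 < 1 - κ := by linarith
  set LL : ℝ := Real.log (Real.log (|γ₀| + 2)) / (2 * η) with hLL_def
  set c₂ : ℝ := clusterFarC0p ψ N 2 p δ η with hc₂_def
  have ea : nearCountWindow ψ N p δ η γ₀ = (c₂ + κ + LL) / (1 - κ) + 1 := rfl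
  rw [ea] at ha
  have hL : 1 < Real.log (|γ₀| + 2) := by
    rw [Real.lt_log_iff_exp_lt (by positivity)]
    linarith [Real.exp_one_lt_d9, abs_nonneg γ₀]
  have hLL : 0 ≤ LL := by have := (Real.log_pos hL).le; positivity
  have hc₂ : 0 ≤ c₂ := clusterFarC0p_nonneg hψ0 hη hΦ N 2 p δ
  have hmul : c₂ + κ + LL ≤ (1 - κ) * c := by
    have h : (c₂ + κ + LL) / (1 - κ) ≤ c := by linarith
    rw [div_le_iff₀ h1κ] at h
    linarith
  have hc0 : 0 ≤ c := (mul_nonneg_iff_of_pos_left h1κ).mp (le_trans (by linarith) hmul)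
  have hc1 : 0 ≤ c + 1 := by linarith
  -- internal parameters
  set R : ℝ := Real.exp ((c + 1) / 2) with hR_def
  set Δ₀ : ℝ := Real.exp ((c + 1) / (2 * p + 2)) with hΔ_def
  have hR : 1 ≤ R := Real.one_le_exp (by positivity)
  have hR1 : Real.exp (c + 1) ≤ R ^ 2 := by
    rw [hR_def, ← Real.exp_nat_mul]; push_cast
    exact Real.exp_le_exp.mpr (by linarith)
  have hΔ1 : 1 ≤ Δ₀ := Real.one_le_exp (by positivity)
  obtain ⟨hθ0, hθ2, hoff⟩ := windowMaxOffset_spec γ₀ R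
  have hΔ : Real.exp (windowMaxOffset γ₀ R * (c + 1)) ≤ Δ₀ ^ (p + 1) := by
    rw [hΔ_def, ← Real.exp_nat_mul]
    refine Real.exp_le_exp.mpr ?_
    have hp : ((p + 1 : ℕ) : ℝ) * ((c + 1) / (2 * p + 2)) = (c + 1) / 2 := by
      push_cast; field_simp
    rw [hp]
    nlinarith
  -- the window inequality with radius `Δ₀ + 1`
  have hkey : clusterFarC0p ψ N (Δ₀ + 1) p δ η + LL ≤ c := by
    have h1 := clusterFarC0p_radius_le ψ N p hδ hη hΦ hΔ1
    have hlogΔ : Real.log Δ₀ = (c + 1) / (2 * p + 2) := by rw [hΔ_def, Real.log_exp]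
    have h2 : 2 * (N : ℝ) / η * Real.log Δ₀ = κ * c + κ := by
      rw [hlogΔ, hκ_def]; field_simp
    have h3 : (1 - κ) * c = c - κ * c := by ring
    rw [h2] at h1
    linarith
  -- the filtered cluster
  set S'' : Finset ℂ := S'.filter (fun ρ ↦ ‖ρ - (1 / 2 + γ₀ * I)‖ ≤ Δ₀ + 1) with hS_def
  have hcard'' : S''.card ≤ N := (Finset.card_filter_le _ _).trans hcard
  have hclus'' : ∀ ρ ∈ S'', ‖ρ - (1 / 2 + γ₀ * I)‖ ≤ Δ₀ + 1 ∧ δ ≤ ‖ρ - (1 / 2 + η + γ₀ * I)‖ ∧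
      δ ≤ ‖ρ - (1 / 2 - η + γ₀ * I)‖ := by
    intro ρ hρ
    rw [hS_def, Finset.mem_filter] at hρ
    exact ⟨hρ.2, (hsep ρ hρ.1).1, (hsep ρ hρ.1).2⟩
  have hloc : ∀ ρ : ℂ, riemannZeta ρ = 0 → 0 ≤ ρ.re → ρ.re ≤ 1 → |ρ.im - γ₀| < R →
      ρ.re ≠ 1 / 2 → ρ = 1 / 2 + η + γ₀ * I ∨ ρ = 1 / 2 - η + γ₀ * I ∨ ρ ∈ S'' ∨ ρ ∈ P ∨
        (|ρ.re - 1 / 2| ≤ windowMaxOffset γ₀ R ∧ Δ₀ ≤ |ρ.im - γ₀|) := by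
    intro ρ hz h0 h1 hRρ hre
    by_cases hn : |ρ.im - γ₀| < Δ₀
    · rcases hnear ρ hz h0 h1 hn hre with h | h | h | h
      · exact Or.inl h
      · exact Or.inr (Or.inl h)
      · refine Or.inr (Or.inr (Or.inl ?_))
        rw [hS_def, Finset.mem_filter]
        refine ⟨h, ?_⟩
        have hre' : (ρ - (1 / 2 + γ₀ * I)).re = ρ.re - 1 / 2 := by simp
        have him' : (ρ - (1 / 2 + γ₀ * I)).im = ρ.im - γ₀ := by simp
        calc ‖ρ - (1 / 2 + γ₀ * I)‖
            ≤ |(ρ - (1 / 2 + γ₀ * I)).re| + |(ρ - (1 / 2 + γ₀ * I)).im| :=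
              Complex.norm_le_abs_re_add_abs_im _
          _ ≤ Δ₀ + 1 := by
              rw [hre', him']
              have hri : |ρ.re - 1 / 2| ≤ 1 / 2 := abs_le.mpr ⟨by linarith, by linarith⟩
              linarith [hn.le]
      · exact Or.inr (Or.inr (Or.inr (Or.inl h)))
    · exact Or.inr (Or.inr (Or.inr (Or.inr ⟨hoff ρ hz h0 h1 hRρ, not_lt.mp hn⟩)))
  exact weilGroundEnergy_neg_of_farOffset_cluster_undodged_window_eff hψ hsupp hψ0 hη hη2 hΦ N
    (Δ₀ + 1) p hδ hδ1 hθ2 γ₀ c R Δ₀ δ₁ S'' P hγ hkey hR hR1 hΔ hΔ1 hζ hcard'' hclus'' hδ₁ hδ₁η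
    hδ₁δ hP hloc

/-! ## T38: the δ-free wall -/

/-- The worst separation scale of the pigeonhole: `δ_N(η, a) = η/(256 a) · (64(N+1))^{-N}`. -/
noncomputable def deltaFree (η a : ℝ) (N : ℕ) : ℝ :=
  η / (256 * a) * (1 / (64 * (N + 1))) ^ N

/-- **T38 (the δ-free near-count wall).**  Hypotheses: `ζ(½+η+iγ₀) = 0` (`0 < η < ½`,
`|γ₀| ≥ 1`), at most `N` other off-line zeros in the zone `|Im ρ − γ₀| < e^{a/(2p+2)}` — a plain
count, no separation, no radius, nothing outside the zone — and the explicit window inequality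
`nearCountWindow ψ N p (deltaFree η a N) η γ₀ ≤ a` (of size `C(ψ, η, N, p) + C' log a +
log log(|γ₀|+2)/(2η(1−κ))`, `κ = N/(η(p+1)) < 1`).  Conclusion: `E₀(a) < 0`. -/
theorem weilGroundEnergy_neg_of_nearCount_eff (hψ : ContDiff ℝ ∞ ψ)
    (hsupp : tsupport ψ ⊆ Icc (-1) 1) (hψ0 : ∀ s, 0 ≤ ψ s) {η : ℝ} (hη : 0 < η)
    (hη2 : η < 1 / 2) (hΦ : 0 < bumpLaplace ψ η) (N p : ℕ) (hκ : (N : ℝ) < η * (p + 1)) :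
    ∀ (γ₀ a : ℝ) (S' : Finset ℂ), 1 ≤ |γ₀| → nearCountWindow ψ N p (deltaFree η a N) η γ₀ ≤ a →
      riemannZeta (1 / 2 + η + γ₀ * I) = 0 → S'.card ≤ N →
      (∀ ρ : ℂ, riemannZeta ρ = 0 → 0 ≤ ρ.re → ρ.re ≤ 1 →
          |ρ.im - γ₀| < Real.exp (a / (2 * p + 2)) → ρ.re ≠ 1 / 2 →
          ρ = 1 / 2 + η + γ₀ * I ∨ ρ = 1 / 2 - η + γ₀ * I ∨ ρ ∈ S') →
      weilGroundEnergy a < 0 := by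
  intro γ₀ a S' hγ ha hζ hcard hnear
  classical
  obtain ⟨c, rfl⟩ : ∃ c, a = c + 1 := ⟨a - 1, by ring⟩
  have ha1 : 1 ≤ c + 1 := (one_le_nearCountWindow hψ0 hη hΦ N p hκ _ hγ).trans ha
  have ha0 : 0 < c + 1 := by linarith
  set θ : ℝ := 1 / (64 * (N + 1)) with hθ_def
  have hθ0 : 0 < θ := by positivity
  have hθ1 : θ ≤ 1 := by
    rw [hθ_def, div_le_one (by positivity)]
    have : (0 : ℝ) ≤ N := N.cast_nonneg
    linarith
  have hθN : 64 * (N + 1) * θ = 1 := by rw [hθ_def]; field_simp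
  set δ₀ : ℝ := η / (256 * (c + 1)) with hδ₀_def
  have hδ₀ : 0 < δ₀ := by positivity
  have hδ₀1 : δ₀ ≤ 1 := by
    rw [hδ₀_def, div_le_one (by positivity)]; linarith
  have h256 : 256 * (c + 1) * δ₀ = η := by rw [hδ₀_def]; field_simp
  set d : ℂ → ℝ := fun ρ ↦ min ‖ρ - (1 / 2 + η + γ₀ * I)‖ ‖ρ - (1 / 2 - η + γ₀ * I)‖
    with hd_def
  -- pigeonhole: an empty shell
  obtain ⟨j, hjN, hj⟩ : ∃ j ≤ N, ∀ ρ ∈ S', ¬(δ₀ * θ ^ (j + 1) ≤ d ρ ∧ d ρ < δ₀ * θ ^ j) := by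
    by_contra hcon
    push Not at hcon
    choose! f hfS hf using hcon
    have hinj : Set.InjOn f ↑(Finset.range (N + 1)) := by
      intro j hj j' hj' heq
      rw [Finset.coe_range, Set.mem_Iio] at hj hj'
      obtain ⟨h1, h2⟩ := hf j (by omega)
      obtain ⟨h1', h2'⟩ := hf j' (by omega)
      rw [heq] at h1 h2
      by_contra hne
      rcases Nat.lt_or_gt_of_ne hne with h | h
      · have := mul_le_mul_of_nonneg_left
          (pow_le_pow_of_le_one hθ0.le hθ1 (by omega : j + 1 ≤ j')) hδ₀.le
        linarith
      · have := mul_le_mul_of_nonneg_left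
          (pow_le_pow_of_le_one hθ0.le hθ1 (by omega : j' + 1 ≤ j)) hδ₀.le
        linarith
    have hc' := Finset.card_le_card_of_injOn f
      (by intro j hj; exact hfS j (by have := Finset.mem_range.mp hj; omega)) hinj
    rw [Finset.card_range] at hc'
    omega
  -- the scales
  set δ : ℝ := δ₀ * θ ^ j with hδ_def
  set δ₁ : ℝ := δ₀ * θ ^ (j + 1) with hδ₁_def
  have hδ : 0 < δ := mul_pos hδ₀ (pow_pos hθ0 j)
  have hδ1 : δ ≤ 1 :=
    (mul_le_of_le_one_right hδ₀.le (pow_le_one₀ hθ0.le hθ1)).trans hδ₀1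
  have hδ₁ : 0 ≤ δ₁ := (mul_pos hδ₀ (pow_pos hθ0 (j + 1))).le
  have hδ₁δ : 64 * (N + 1) * δ₁ = δ := by
    rw [hδ₁_def, hδ_def, pow_succ]
    calc 64 * (N + 1) * (δ₀ * (θ ^ j * θ)) = 64 * (N + 1) * θ * (δ₀ * θ ^ j) := by ring
      _ = δ₀ * θ ^ j := by rw [hθN, one_mul]
  have hδ₁η : 256 * (c + 1) * δ₁ ≤ η := by
    calc 256 * (c + 1) * δ₁ = 256 * (c + 1) * δ₀ * θ ^ (j + 1) := by rw [hδ₁_def]; ring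
      _ = η * θ ^ (j + 1) := by rw [h256]
      _ ≤ η := mul_le_of_le_one_right hη.le (pow_le_one₀ hθ0.le hθ1)
  have hδ₁1 : δ₁ < 1 := by
    have h1 : δ₁ ≤ δ₀ := mul_le_of_le_one_right hδ₀.le (pow_le_one₀ hθ0.le hθ1)
    have h2 : δ₀ < 1 := by
      rw [hδ₀_def, div_lt_one (by positivity)]; nlinarith
    linarith
  -- the window at scale `δ`
  have hfree : deltaFree η (c + 1) N ≤ δ := by
    change δ₀ * θ ^ N ≤ δ₀ * θ ^ j
    exact mul_le_mul_of_nonneg_left (pow_le_pow_of_le_one hθ0.le hθ1 hjN) hδ₀.le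
  have hfree0 : 0 < deltaFree η (c + 1) N := by
    change 0 < δ₀ * θ ^ N
    exact mul_pos hδ₀ (pow_pos hθ0 N)
  have hwin : nearCountWindow ψ N p δ η γ₀ ≤ c + 1 :=
    (nearCountWindow_anti ψ N p γ₀ hfree0 hfree hη hκ).trans ha
  -- the dodged and the un-dodged members
  set S'' : Finset ℂ := S'.filter (fun ρ ↦ δ ≤ d ρ) with hS_def
  set P : Finset ℂ :=
    S'.filter (fun ρ ↦ d ρ < δ₁ ∧ riemannZeta ρ = 0 ∧ 0 ≤ ρ.re ∧ ρ.re ≤ 1) with hP_def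
  have hcard'' : S''.card ≤ N := (Finset.card_filter_le _ _).trans hcard
  have hsep'' : ∀ ρ ∈ S'', δ ≤ ‖ρ - (1 / 2 + η + γ₀ * I)‖ ∧
      δ ≤ ‖ρ - (1 / 2 - η + γ₀ * I)‖ := by
    intro ρ hρ
    rw [hS_def, Finset.mem_filter] at hρ
    exact le_min_iff.mp hρ.2
  have hP : ∀ ρ ∈ P, riemannZeta ρ = 0 ∧ 0 ≤ ρ.re ∧ ρ.re ≤ 1 ∧ ρ.im ≠ 0 ∧
      (‖ρ - (1 / 2 + η + γ₀ * I)‖ ≤ δ₁ ∨ ‖ρ - (1 / 2 - η + γ₀ * I)‖ ≤ δ₁) := by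
    intro ρ hρ
    rw [hP_def, Finset.mem_filter] at hρ
    obtain ⟨-, hd1, hz, h0, h1⟩ := hρ
    refine ⟨hz, h0, h1, ?_, ?_⟩
    · intro him
      have e0 : (ρ - (1 / 2 + η + γ₀ * I)).im = -γ₀ := by simp [him]
      have e1 : (ρ - (1 / 2 - η + γ₀ * I)).im = -γ₀ := by simp [him]
      have i0 : |γ₀| ≤ ‖ρ - (1 / 2 + η + γ₀ * I)‖ := by
        have := Complex.abs_im_le_norm (ρ - (1 / 2 + η + γ₀ * I)); rwa [e0, abs_neg] at this
      have i1 : |γ₀| ≤ ‖ρ - (1 / 2 - η + γ₀ * I)‖ := by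
        have := Complex.abs_im_le_norm (ρ - (1 / 2 - η + γ₀ * I)); rwa [e1, abs_neg] at this
      have : |γ₀| ≤ d ρ := le_min i0 i1
      linarith
    · rcases min_lt_iff.mp hd1 with h | h
      · exact Or.inl h.le
      · exact Or.inr h.le
  have hnear4 : ∀ ρ : ℂ, riemannZeta ρ = 0 → 0 ≤ ρ.re → ρ.re ≤ 1 →
      |ρ.im - γ₀| < Real.exp ((c + 1) / (2 * p + 2)) → ρ.re ≠ 1 / 2 →
      ρ = 1 / 2 + η + γ₀ * I ∨ ρ = 1 / 2 - η + γ₀ * I ∨ ρ ∈ S'' ∨ ρ ∈ P := by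
    intro ρ hz h0 h1 hn hre
    rcases hnear ρ hz h0 h1 hn hre with h | h | h
    · exact Or.inl h
    · exact Or.inr (Or.inl h)
    · by_cases hdρ : δ ≤ d ρ
      · refine Or.inr (Or.inr (Or.inl ?_))
        rw [hS_def, Finset.mem_filter]
        exact ⟨h, hdρ⟩
      · refine Or.inr (Or.inr (Or.inr ?_))
        rw [hP_def, Finset.mem_filter]
        refine ⟨h, ?_, hz, h0, h1⟩
        by_contra hd1
        exact hj ρ h ⟨not_lt.mp hd1, not_le.mp hdρ⟩
  exact weilGroundEnergy_neg_of_nearCount_undodged_eff hψ hsupp hψ0 hη hη2 hΦ N p hκ hδ hδ1 γ₀ c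
    δ₁ S'' P hγ hwin hζ hcard'' hsep'' hδ₁ hδ₁η hδ₁δ.le hP hnear4

/-- **T38″ (exclusion form of the δ-free wall).**  If `E₀(a) ≥ 0` and at most `N` off-line
zeros other than the pair lie in the zone, then `ζ(½+η+iγ₀) ≠ 0`. -/
theorem riemannZeta_ne_zero_of_nearCount_eff (hψ : ContDiff ℝ ∞ ψ)
    (hsupp : tsupport ψ ⊆ Icc (-1) 1) (hψ0 : ∀ s, 0 ≤ ψ s) {η : ℝ} (hη : 0 < η)
    (hη2 : η < 1 / 2) (hΦ : 0 < bumpLaplace ψ η) (N p : ℕ) (hκ : (N : ℝ) < η * (p + 1)) :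
    ∀ (γ₀ a : ℝ) (S' : Finset ℂ), 1 ≤ |γ₀| → nearCountWindow ψ N p (deltaFree η a N) η γ₀ ≤ a →
      S'.card ≤ N →
      (∀ ρ : ℂ, riemannZeta ρ = 0 → 0 ≤ ρ.re → ρ.re ≤ 1 →
          |ρ.im - γ₀| < Real.exp (a / (2 * p + 2)) → ρ.re ≠ 1 / 2 →
          ρ = 1 / 2 + η + γ₀ * I ∨ ρ = 1 / 2 - η + γ₀ * I ∨ ρ ∈ S') →
      0 ≤ weilGroundEnergy a → riemannZeta (1 / 2 + η + γ₀ * I) ≠ 0 := by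
  intro γ₀ a S' hγ ha hcard hnear hE hζ
  have := weilGroundEnergy_neg_of_nearCount_eff hψ hsupp hψ0 hη hη2 hΦ N p hκ γ₀ a S' hγ ha hζ
    hcard hnear
  linarith

end Summit.RiemannHypothesis.RiemannHypothesis.Theorems
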